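import Literature.Probability.Percolation.SelfRefinementMeasure
import Literature.Probability.Percolation.KohlerSchindlerTassionRSW

/-!
# Stub `stub_phaseDiagramLandmarksB` of line `finite-size-envelope` — part 1: straight runs

Route `CardySelfRefinement`, crux `CriticalPathRSW` (stmt-CriticalPhenomena-10267), line
`finite-size-envelope`, stub `stub_phaseDiagramLandmarksB` (landmarks of the finite-size phase
diagram: two-sided certificates at the endpoints `(1,0)`, `(0,½)` and the bottom edge `c = 0`).

This first helper file is pure lattice combinatorics, the core of the **fine-to-coarse transfer of
crossings**: in a bond configuration `ω` of `ℤ²` all of whose open lattice edges are axial for the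
refinement factor `k` (`IsAxialEdge k`, i.e. lie on the lines of `kℤ²` — almost surely the case
under `M_k(ρ, 0)`, whose interior edges are closed), an open self-avoiding path which enters the
interior of a subdivided coarse edge (a "tuple" of `k` collinear axial edges) must run straight
through it to the far end: the interior vertices of the tuple have no other open edges
(`eq_add_or_sub_single_of_adj`), and a path never turns back (`straight_run`). The two
parametrisations of a tuple used downstream — ascending `i ↦ k u + i e_d` and descending
`i ↦ k u + (k - i) e_d` — are supplied with their neighbour and end-point lemmas.

References: Kesten 1982 Ch. 5 / Grimmett 1999 §11.7 (block arguments; here only the trivial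
deterministic part of a coarse-graining), Beffara 2008 §5.1 (the subdivided lattice `kℤ²` inside
`ℤ²`).
-/

namespace Summit.CriticalPhenomena.CardyFormulaZ2.Cruxes.CriticalPathRSW.FiniteSizeEnvelope

open Set
open Literature.Probability.LatticeModels Literature.Probability.Percolation
open SimpleGraph

/-! ### Open edges at non-coarse vertices -/

/-- The coordinate orthogonal to the direction `i` is `d` as soon as `i ≠ d` (in `Fin 2`). [folklore] -/
theorem perp_eq_of_ne {i d : Fin 2} (h : i ≠ d) : (if i = 0 then (1 : Fin 2) else 0) = d := by
  fin_cases i <;> fin_cases d <;> simp_all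

/-- **No turning inside a tuple.** If every open lattice edge of `ω` is axial for `k` and the
vertex `v` has `k ∤ v d`, then every open lattice edge at `v` is parallel to `e_d`: its other
endpoint is `v + e_d` or `v - e_d`. [folklore] -/
theorem eq_add_or_sub_single_of_adj {k : ℕ} {ω : BondConfig (Site 2)}
    (hax : ∀ e, cornerEdge e ∈ ω → IsAxialEdge k e) {v z : Site 2} {d : Fin 2}
    (hv : ¬ (k : ℤ) ∣ v d) (hadj : (zdGraph 2).Adj v z) (hz : s(v, z) ∈ ω) :
    z = v + Pi.single d 1 ∨ z = v - Pi.single d 1 := by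
  obtain ⟨i, h | h⟩ := (zdGraph_adj_iff v z).1 hadj
  · have hmem : cornerEdge (v, i) ∈ ω := by
      have he : cornerEdge (v, i) = s(v, z) := by rw [cornerEdge, h]
      rw [he]; exact hz
    by_cases hid : i = d
    · subst hid; exact Or.inl h
    · exfalso
      have hax' := hax _ hmem
      rw [isAxialEdge_iff, perp_eq_of_ne hid] at hax'
      exact hv hax'
  · have hmem : cornerEdge (z, i) ∈ ω := by
      have he : cornerEdge (z, i) = s(v, z) := by rw [cornerEdge, ← h, Sym2.eq_swap]
      rw [he]; exact hz
    by_cases hid : i = d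
    · subst hid
      exact Or.inr (by rw [h, add_sub_cancel_right])
    · exfalso
      have hax' := hax _ hmem
      rw [isAxialEdge_iff, perp_eq_of_ne hid] at hax'
      have hvd : v d = z d := by rw [h, Pi.add_apply, Pi.single_eq_of_ne (Ne.symm hid), add_zero]
      exact hv (hvd ▸ hax')

/-- `k ∤ i` for `0 < i < k`. [folklore] -/
theorem not_dvd_of_pos_of_lt {k i : ℕ} (hi : 0 < i) (hik : i < k) : ¬ (k : ℤ) ∣ (i : ℤ) := by
  intro h
  exact absurd (Nat.le_of_dvd hi (Int.natCast_dvd_natCast.1 h)) (not_le.2 hik)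

/-- `k ∤ k m + i` for `0 < i < k`. [folklore] -/
theorem not_dvd_mul_add {k i : ℕ} (m : ℤ) (hi : 0 < i) (hik : i < k) : ¬ (k : ℤ) ∣ (k : ℤ) * m + i := by
  intro h
  exact not_dvd_of_pos_of_lt hi hik ((Int.dvd_add_right (dvd_mul_right _ _)).1 h)

/-! ### Straight runs along an abstract line -/

/-- **A self-avoiding open path runs straight through a tuple.** Let `L 0, …, L k` be the vertices
of a subdivided coarse edge (abstractly: at each interior vertex `L i`, `0 < i < k`, every open
lattice edge leads to `L (i ± 1)`, and the target `y` is not interior). A self-avoiding walk of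
`ℤ²` with open edges which stands at the interior vertex `L j` and does not contain `L (j-1)`
continues through `L (j+1), …, L k`; the remainder from `L k` is a shorter sub-walk, and the edges
`{L i, L (i+1)}`, `j ≤ i < k`, are open. (Induction on `m = k - 1 - j`.) [folklore] -/
theorem straight_run {k : ℕ} {ω : BondConfig (Site 2)} (L : ℕ → Site 2) {y : Site 2}
    (hnb : ∀ i z, 0 < i → i < k → (zdGraph 2).Adj (L i) z → s(L i, z) ∈ ω →
      z = L (i + 1) ∨ z = L (i - 1))
    (hy : ∀ i, 0 < i → i < k → L i ≠ y) :
    ∀ (m j : ℕ), j + m + 1 = k → 0 < j → ∀ {v : Site 2} (p : (zdGraph 2).Walk v y), v = L j →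
      p.IsPath → (∀ e ∈ p.edges, e ∈ ω) → L (j - 1) ∉ p.support →
      ∃ q : (zdGraph 2).Walk (L k) y, q.IsPath ∧ q.length < p.length ∧ q.support ⊆ p.support ∧
        q.edges ⊆ p.edges ∧ ∀ i, j ≤ i → i < k → s(L i, L (i + 1)) ∈ ω := by
  intro m
  induction m with
  | zero =>
    intro j hjk hj v p hv hp hω hprev
    cases p with
    | nil => exact absurd hv.symm (hy j hj (by omega))
    | cons h p' =>
      rename_i z
      subst hv
      have he : s(L j, z) ∈ ω := hω _ (by simp [Walk.edges_cons])
      rcases hnb j z hj (by omega) h he with rfl | rfl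
      · have hk : j + 1 = k := by omega
        subst hk
        refine ⟨p', ((Walk.cons_isPath_iff h p').1 hp).1, by simp [Walk.length_cons],
          fun x hx => by simp [Walk.support_cons, hx], fun e he' => by simp [Walk.edges_cons, he'],
          fun i hi hik => ?_⟩
        obtain rfl : i = j := by omega
        exact he
      · exact absurd (by simp [Walk.support_cons]) hprev
  | succ m ih =>
    intro j hjk hj v p hv hp hω hprev
    cases p with
    | nil => exact absurd hv.symm (hy j hj (by omega))
    | cons h p' =>
      rename_i z
      subst hv
      have he : s(L j, z) ∈ ω := hω _ (by simp [Walk.edges_cons])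
      rcases hnb j z hj (by omega) h he with rfl | rfl
      · have hp' := (Walk.cons_isPath_iff h p').1 hp
        obtain ⟨q, hq, hlen, hsupp, hedges, hall⟩ := ih (j + 1) (by omega) (by omega) p' rfl hp'.1
          (fun e he' => hω e (by simp [Walk.edges_cons, he'])) (by simpa using hp'.2)
        refine ⟨q, hq, by simp only [Walk.length_cons]; omega,
          fun x hx => by simp [Walk.support_cons, hsupp hx],
          fun e he' => by simp [Walk.edges_cons, hedges he'], fun i hi hik => ?_⟩
        rcases Nat.eq_or_lt_of_le hi with rfl | hlt
        · exact he
        · exact hall i (by omega) hik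
      · exact absurd (by simp [Walk.support_cons]) hprev


/-! ### The two parametrisations of a tuple -/

/-- `k u + i e_d + e_d = k u + (i+1) e_d`. [folklore] -/
theorem smul_add_single_add_single (k : ℕ) (u : Site 2) (d : Fin 2) (i : ℤ) :
    (k : ℤ) • u + Pi.single d i + Pi.single d 1 = (k : ℤ) • u + Pi.single d (i + 1) := by
  rw [add_assoc, ← Pi.single_add]

/-- `k u + i e_d - e_d = k u + (i-1) e_d`. [folklore] -/
theorem smul_add_single_sub_single (k : ℕ) (u : Site 2) (d : Fin 2) (i : ℤ) :
    (k : ℤ) • u + Pi.single d i - Pi.single d 1 = (k : ℤ) • u + Pi.single d (i - 1) := by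
  rw [add_sub_assoc, ← Pi.single_sub]

/-- `k u + k e_d = k (u + e_d)`. [folklore] -/
theorem smul_add_single_self (k : ℕ) (u : Site 2) (d : Fin 2) :
    (k : ℤ) • u + Pi.single d (k : ℤ) = (k : ℤ) • (u + Pi.single d 1) := by
  rw [smul_add, ← Pi.single_smul, smul_eq_mul, mul_one]

/-- The `d`-coordinate of `k u + i e_d` is `k u_d + i`. [folklore] -/
theorem smul_add_single_apply_same (k : ℕ) (u : Site 2) (d : Fin 2) (i : ℤ) :
    ((k : ℤ) • u + Pi.single d i : Site 2) d = (k : ℤ) * u d + i := by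
  simp

/-- The `0`-coordinate of `k u + i e_1` is `k u_0`. [folklore] -/
theorem smul_add_single_one_apply_zero (k : ℕ) (u : Site 2) (i : ℤ) :
    ((k : ℤ) • u + Pi.single (1 : Fin 2) i : Site 2) 0 = (k : ℤ) * u 0 := by
  simp

/-- **Neighbours along the ascending line** `L i = k u + i e_d`: at an interior vertex
(`0 < i < k`) every open lattice edge of an all-axial configuration leads to `L (i ± 1)`. [folklore] -/
theorem nb_up {k : ℕ} {ω : BondConfig (Site 2)} (hax : ∀ e, cornerEdge e ∈ ω → IsAxialEdge k e)
    (u : Site 2) (d : Fin 2) :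
    ∀ (i : ℕ) (z : Site 2), 0 < i → i < k →
      (zdGraph 2).Adj ((k : ℤ) • u + Pi.single d (i : ℤ)) z → s((k : ℤ) • u + Pi.single d (i : ℤ), z) ∈ ω →
      z = (k : ℤ) • u + Pi.single d ((i + 1 : ℕ) : ℤ) ∨ z = (k : ℤ) • u + Pi.single d ((i - 1 : ℕ) : ℤ) := by
  intro i z hi hik hadj hz
  have hv : ¬ (k : ℤ) ∣ ((k : ℤ) • u + Pi.single d (i : ℤ) : Site 2) d := by
    rw [smul_add_single_apply_same]; exact not_dvd_mul_add _ hi hik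
  rcases eq_add_or_sub_single_of_adj hax hv hadj hz with rfl | rfl
  · exact Or.inl (by rw [smul_add_single_add_single]; push_cast; rfl)
  · exact Or.inr (by rw [smul_add_single_sub_single, Nat.cast_pred hi])

/-- **Neighbours along the descending line** `L i = k u + (k - i) e_d`. [folklore] -/
theorem nb_down {k : ℕ} {ω : BondConfig (Site 2)} (hax : ∀ e, cornerEdge e ∈ ω → IsAxialEdge k e)
    (u : Site 2) (d : Fin 2) :
    ∀ (i : ℕ) (z : Site 2), 0 < i → i < k →
      (zdGraph 2).Adj ((k : ℤ) • u + Pi.single d ((k : ℤ) - i)) z →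
      s((k : ℤ) • u + Pi.single d ((k : ℤ) - i), z) ∈ ω →
      z = (k : ℤ) • u + Pi.single d ((k : ℤ) - ((i + 1 : ℕ) : ℤ)) ∨
        z = (k : ℤ) • u + Pi.single d ((k : ℤ) - ((i - 1 : ℕ) : ℤ)) := by
  intro i z hi hik hadj hz
  obtain ⟨i', hi'⟩ : ∃ i' : ℕ, i' + i = k := ⟨k - i, by omega⟩
  have hsub : (k : ℤ) - i = (i' : ℕ) := by rw [← hi']; push_cast; ring
  have hv : ¬ (k : ℤ) ∣ ((k : ℤ) • u + Pi.single d ((k : ℤ) - i) : Site 2) d := by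
    rw [smul_add_single_apply_same, hsub]; exact not_dvd_mul_add _ (by omega) (by omega)
  rcases eq_add_or_sub_single_of_adj hax hv hadj hz with rfl | rfl
  · exact Or.inr (by rw [smul_add_single_add_single, Nat.cast_pred hi]; congr 2; ring)
  · exact Or.inl (by rw [smul_add_single_sub_single]; push_cast; congr 2; ring)

/-- **The target is not interior (ascending line).** If `y₀ = k a`, and in the vertical case the
line is not the line `x₀ = k a`, then no interior vertex of the ascending line is `y`. [folklore] -/
theorem ne_up {k : ℕ} (u : Site 2) (d : Fin 2) {y : Site 2} {a : ℤ} (hy : y 0 = (k : ℤ) * a)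
    (hne : d = 1 → u 0 ≠ a) (hk : 0 < k) :
    ∀ i : ℕ, 0 < i → i < k → (k : ℤ) • u + Pi.single d (i : ℤ) ≠ y := by
  intro i hi hik h
  have h0 := congrArg (fun x : Site 2 => x 0) h
  fin_cases d
  · simp only [Fin.zero_eta, Pi.add_apply, Pi.smul_apply, smul_eq_mul, Pi.single_eq_same, hy] at h0
    refine not_dvd_mul_add (u 0 - a) hi hik ⟨0, ?_⟩
    linear_combination h0
  · simp only [Fin.mk_one, Pi.add_apply, Pi.smul_apply, smul_eq_mul, hy,
      Pi.single_eq_of_ne (show (0 : Fin 2) ≠ 1 by decide), add_zero] at h0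
    exact hne rfl (mul_left_cancel₀ (by exact_mod_cast hk.ne') h0)

/-- **The target is not interior (descending line).** [folklore] -/
theorem ne_down {k : ℕ} (u : Site 2) (d : Fin 2) {y : Site 2} {a : ℤ} (hy : y 0 = (k : ℤ) * a)
    (hne : d = 1 → u 0 ≠ a) (hk : 0 < k) :
    ∀ i : ℕ, 0 < i → i < k → (k : ℤ) • u + Pi.single d ((k : ℤ) - i) ≠ y := by
  intro i hi hik
  obtain ⟨i', hi'⟩ : ∃ i' : ℕ, i' + i = k := ⟨k - i, by omega⟩
  have hsub : (k : ℤ) - i = (i' : ℕ) := by rw [← hi']; push_cast; ring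
  rw [hsub]
  exact ne_up u d hy hne hk i' (by omega) (by omega)

/-! ### Boxes -/

/-- Membership in `KST2023.box` without absolute values. [folklore] -/
theorem mem_box_iff' {m n : ℕ} {x : Site 2} :
    x ∈ KST2023.box m n ↔ -(m : ℤ) ≤ x 0 ∧ x 0 ≤ m ∧ -(n : ℤ) ≤ x 1 ∧ x 1 ≤ n := by
  rw [KST2023.mem_box, abs_le, abs_le, and_assoc]

/-- **Coarse vertices of the fine box are the coarse box**: `k u ∈ [-ka, ka] × [-kb, kb]` iff
`u ∈ [-a, a] × [-b, b]` (`k ≥ 1`). [folklore] -/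
theorem smul_mem_box_iff {k : ℕ} (hk : 0 < k) {a b : ℕ} {u : Site 2} :
    (k : ℤ) • u ∈ KST2023.box (k * a) (k * b) ↔ u ∈ KST2023.box a b := by
  have hk' : (0 : ℤ) < k := by exact_mod_cast hk
  simp only [KST2023.mem_box, Pi.smul_apply, smul_eq_mul, abs_mul, Nat.cast_mul,
    abs_of_pos hk']
  rw [mul_le_mul_iff_of_pos_left hk', mul_le_mul_iff_of_pos_left hk']

/-! ### From a coarse vertex to the right side -/

/-- One coarse step: glue an open coarse edge `{u, u₁}` inside the coarse box to a coarse
connection from `u₁`. [folklore] -/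
theorem openConnIn_of_edge_of_openConnIn {ωc : BondConfig (Site 2)} {S : Set (Site 2)}
    {u u₁ u' : Site 2} (hu : u ∈ S) (he : s(u, u₁) ∈ ωc) (hne : u ≠ u₁)
    (hconn : ωc ∈ openConnIn S u₁ u') : ωc ∈ openConnIn S u u' := by
  exact PlanarDuality.openConnIn_trans (openConnIn_of_adj hu hconn.1 he hne) hconn

/-- **From a coarse vertex to the right side, coarsely.** Let every open lattice edge of `ω` be
axial for `k ≥ 2`, and let the coarse configuration `ωc` contain the coarse edge `{u, u + e_d}`
whenever the `k` sub-edges `{k u + j e_d, k u + (j+1) e_d}`, `j < k`, of its tuple are open in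
`ω`. Then a self-avoiding walk of `ℤ²` with open edges, inside the fine box
`[-ka, ka] × [-kb, kb]`, from a coarse vertex `k u` to a vertex `y` of the right side `y₀ = k a`,
yields an `ωc`-open path inside the coarse box `[-a, a] × [-b, b]` from `u` to a vertex `u'` of its
right side `u'₀ = a`: the walk runs straight through every tuple it enters (`straight_run`), and
its coarse vertices form the coarse path. (Strong induction on the length.) [folklore] -/
theorem coarse_path_of_fine_path {k a b : ℕ} (hk : 2 ≤ k) {ω ωc : BondConfig (Site 2)}
    (hax : ∀ e, cornerEdge e ∈ ω → IsAxialEdge k e)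
    (hωc : ∀ (u : Site 2) (d : Fin 2), (∀ j : ℕ, j < k →
      s((k : ℤ) • u + Pi.single d (j : ℤ), (k : ℤ) • u + Pi.single d ((j : ℤ) + 1)) ∈ ω) →
      s(u, u + Pi.single d 1) ∈ ωc)
    {y : Site 2} (hy : y 0 = (k : ℤ) * a) :
    ∀ (n : ℕ) {v : Site 2} (u : Site 2) (p : (zdGraph 2).Walk v y), v = (k : ℤ) • u → p.IsPath →
      p.length ≤ n → (∀ z ∈ p.support, z ∈ KST2023.box (k * a) (k * b)) →
      (∀ e ∈ p.edges, e ∈ ω) → ∃ u' : Site 2, u' 0 = a ∧ ωc ∈ openConnIn (KST2023.box a b) u u' := by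
  have hk0 : 0 < k := by omega
  have hk0' : (k : ℤ) ≠ 0 := by exact_mod_cast hk0.ne'
  intro n
  induction n with
  | zero =>
    intro v u p hv hp hlen hS hω
    cases p with
    | nil =>
      subst hv
      have hu : u ∈ KST2023.box a b := (smul_mem_box_iff hk0).1 (hS _ (Walk.start_mem_support _))
      refine ⟨u, ?_, openConnIn_refl hu⟩
      have h0 : (k : ℤ) * u 0 = (k : ℤ) * a := by simpa using hy
      exact mul_left_cancel₀ hk0' h0
    | cons _ _ => simp at hlen
  | succ n ih =>
    intro v u p hv hp hlen hS hω
    have hu : u ∈ KST2023.box a b := (smul_mem_box_iff hk0).1 (hv ▸ hS _ (Walk.start_mem_support _))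
    by_cases hu0 : u 0 = a
    · exact ⟨u, hu0, openConnIn_refl hu⟩
    cases p with
    | nil =>
      subst hv
      have h0 : (k : ℤ) * u 0 = (k : ℤ) * a := by simpa using hy
      exact absurd (mul_left_cancel₀ hk0' h0) hu0
    | cons h p' =>
      rename_i z
      subst hv
      have hp' := (Walk.cons_isPath_iff h p').1 hp
      have he : s((k : ℤ) • u, z) ∈ ω := hω _ (by simp [Walk.edges_cons])
      have hω' : ∀ e ∈ p'.edges, e ∈ ω := fun e he' => hω e (by simp [Walk.edges_cons, he'])
      -- the segment entered by the first step, as a line `L` with `L 0 = k u`, `L 1 = z`,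
      -- `L k = k u₁`, run straight through; then recurse from `u₁`
      suffices hseg : ∃ (u₁ : Site 2) (q : (zdGraph 2).Walk ((k : ℤ) • u₁) y), s(u, u₁) ∈ ωc ∧ u ≠ u₁ ∧
          q.IsPath ∧ q.length < (Walk.cons h p').length ∧ q.support ⊆ (Walk.cons h p').support ∧
          q.edges ⊆ (Walk.cons h p').edges by
        obtain ⟨u₁, q, he₁, hne, hq, hqlen, hqsupp, hqedges⟩ := hseg
        obtain ⟨u', hu', hconn⟩ := ih u₁ q rfl hq (by omega) (fun z hz => hS z (hqsupp hz))
          (fun e he' => hω e (hqedges he'))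
        exact ⟨u', hu', openConnIn_of_edge_of_openConnIn hu he₁ hne hconn⟩
      obtain ⟨d, hz | hz⟩ := (zdGraph_adj_iff _ _).1 h
      · -- ascending: `z = k u + e_d`, line `L i = k u + i e_d`, far end `k (u + e_d)`
        set L : ℕ → Site 2 := fun i => (k : ℤ) • u + Pi.single d (i : ℤ) with hL
        have hL0 : L 0 = (k : ℤ) • u := by simp [hL]
        have hL1 : L 1 = z := by rw [hz, hL]; simp
        have hLk : L k = (k : ℤ) • (u + Pi.single d 1) := by rw [hL]; exact smul_add_single_self k u d
        obtain ⟨q, hq, hqlen, hqsupp, hqedges, hall⟩ := straight_run (ω := ω) L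
          (fun i w hi hik hadj hw => nb_up hax u d i w hi hik hadj hw)
          (ne_up u d hy (fun _ => hu0) hk0) (k - 2) 1 (by omega) one_pos p' hL1.symm hp'.1 hω'
          (by rw [show (1 - 1 : ℕ) = 0 from rfl, hL0]; exact hp'.2)
        refine ⟨u + Pi.single d 1, q.copy hLk rfl, hωc u d fun j hj => ?_, fun h' => ?_,
          (Walk.isPath_copy _ _ _).2 hq, ?_, ?_, ?_⟩
        · rcases Nat.eq_zero_or_pos j with rfl | hj0
          · simpa [hz] using he
          · have := hall j hj0 hj
            simp only [hL] at this
            push_cast at this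
            exact this
        · have := congrArg (fun x : Site 2 => x d) h'
          simp at this
        · rw [Walk.length_copy, Walk.length_cons]; omega
        · rw [Walk.support_copy, Walk.support_cons]
          exact fun x hx => List.mem_cons_of_mem _ (hqsupp hx)
        · rw [Walk.edges_copy, Walk.edges_cons]
          exact fun e he' => List.mem_cons_of_mem _ (hqedges he')
      · -- descending: `z = k u - e_d`, line `L i = k u₀ + (k - i) e_d`, `u₀ = u - e_d`, far end `k u₀`
        set u₀ : Site 2 := u - Pi.single d 1 with hu₀
        have huu₀ : u = u₀ + Pi.single d 1 := by rw [hu₀, sub_add_cancel]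
        set L : ℕ → Site 2 := fun i => (k : ℤ) • u₀ + Pi.single d ((k : ℤ) - i) with hL
        have hL0 : L 0 = (k : ℤ) • u := by
          simp only [hL, Nat.cast_zero, sub_zero]
          rw [smul_add_single_self, ← huu₀]
        have hL1 : L 1 = z := by
          rw [eq_sub_of_add_eq hz.symm, ← hL0, hL]
          simp only [Nat.cast_zero, sub_zero, Nat.cast_one]
          rw [smul_add_single_sub_single]
        have hLk : L k = (k : ℤ) • u₀ := by simp [hL]
        have hne0 : d = 1 → u₀ 0 ≠ a := by
          rintro rfl
          rw [hu₀, Pi.sub_apply, Pi.single_eq_of_ne (show (0 : Fin 2) ≠ 1 by decide), sub_zero]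
          exact hu0
        obtain ⟨q, hq, hqlen, hqsupp, hqedges, hall⟩ := straight_run (ω := ω) L
          (fun i w hi hik hadj hw => nb_down hax u₀ d i w hi hik hadj hw)
          (ne_down u₀ d hy hne0 hk0) (k - 2) 1 (by omega) one_pos p' hL1.symm hp'.1 hω'
          (by rw [show (1 - 1 : ℕ) = 0 from rfl, hL0]; exact hp'.2)
        refine ⟨u₀, q.copy hLk rfl, ?_, fun h' => ?_, (Walk.isPath_copy _ _ _).2 hq, ?_, ?_, ?_⟩
        · have hall' : ∀ i, i < k → s(L i, L (i + 1)) ∈ ω := by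
            intro i hi
            rcases Nat.eq_zero_or_pos i with rfl | hi0
            · rw [hL0, hL1]; exact he
            · exact hall i hi0 hi
          have hedge : s(u₀, u₀ + Pi.single d 1) ∈ ωc := by
            refine hωc u₀ d fun j hj => ?_
            obtain ⟨i, hi⟩ : ∃ i : ℕ, i + j + 1 = k := ⟨k - j - 1, by omega⟩
            have h1 : (k : ℤ) - i = (j : ℤ) + 1 := by rw [← hi]; push_cast; ring
            have h2 : (k : ℤ) - ((i + 1 : ℕ) : ℤ) = (j : ℤ) := by rw [← hi]; push_cast; ring
            have h := hall' i (by omega)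
            simp only [hL] at h
            rw [h1, h2, Sym2.eq_swap] at h
            exact h
          rw [← huu₀, Sym2.eq_swap] at hedge
          exact hedge
        · have := congrArg (fun x : Site 2 => x d) h'
          simp [hu₀] at this
          linarith
        · rw [Walk.length_copy, Walk.length_cons]; omega
        · rw [Walk.support_copy, Walk.support_cons]
          exact fun x hx => List.mem_cons_of_mem _ (hqsupp hx)
        · rw [Walk.edges_copy, Walk.edges_cons]
          exact fun e he' => List.mem_cons_of_mem _ (hqedges he')

/-! ### Registered sub-goal -/

/-- **Registered sub-goal `stub_phaseDiagramLandmarksB_pathLift`** (serves stub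
`stub_phaseDiagramLandmarksB` of stmt-CriticalPhenomena-10267): `coarse_path_of_fine_path` with the
walk's own length as the induction bound — from a coarse vertex `k u`, a self-avoiding walk of `ℤ²`
with open, all-axial edges inside `[-ka, ka] × [-kb, kb]` to the right side `y₀ = ka` yields an open
coarse path inside `[-a, a] × [-b, b]` from `u` to the right side `u'₀ = a` of any coarse
configuration `ωc` containing the coarse edges whose tuples are fully open. [folklore] -/
theorem stub_phaseDiagramLandmarksB_pathLift :
    ∀ (k a b : ℕ), 2 ≤ k → ∀ (ω ωc : BondConfig (Site 2)), (∀ e, cornerEdge e ∈ ω → IsAxialEdge k e) →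
      (∀ (u : Site 2) (d : Fin 2), (∀ j : ℕ, j < k →
        s((k : ℤ) • u + Pi.single d (j : ℤ), (k : ℤ) • u + Pi.single d ((j : ℤ) + 1)) ∈ ω) →
        s(u, u + Pi.single d 1) ∈ ωc) →
      ∀ (y : Site 2), y 0 = (k : ℤ) * a → ∀ (u : Site 2) (p : (zdGraph 2).Walk ((k : ℤ) • u) y), p.IsPath →
        (∀ z ∈ p.support, z ∈ KST2023.box (k * a) (k * b)) → (∀ e ∈ p.edges, e ∈ ω) →
        ∃ u' : Site 2, u' 0 = a ∧ ωc ∈ openConnIn (KST2023.box a b) u u' := by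
  intro k a b hk ω ωc hax hωc y hy u p hp hS hω
  exact coarse_path_of_fine_path hk hax hωc hy p.length u p rfl hp le_rfl hS hω

end Summit.CriticalPhenomena.CardyFormulaZ2.Cruxes.CriticalPathRSW.FiniteSizeEnvelope
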